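import Summits.QuantumFields.QCD.Theses.ChiralSpinWaves

/-!
# Crux `MassiveBody` (stmt-QuantumFields-16583, route ChiralSpinWaves, rank 4), negative side:
# the window hypotheses do not pin the critical mass — `MassiveBody` forces MASS-BLIND continuum limits

Refuter vetting file (crux-attack, 2026-08-17).  NO refutation is claimed (`¬ MassiveBody` needs an honest window
regularisation, which the tree cannot construct); this is the kernel-checked form of the loophole described in prose
in `Cruxes/MassiveBody/Lines/birth.md` §Caveat.  `MassiveBody` quantifies over EVERY `reg` with `HasMassScaling`,
asymptotic scaling and the two window laws of `ChiralWindow` (constants `m₁, c, C`) and concludes the `QCDOf` body —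
FULL-SEQUENCE convergence `IsQCDAlong` to non-trivial gapped OS data — at every positive mass tuple.  Given such a
`reg` and `0 ≤ M < m₁`, interleave `reg` with its RGI up-shift (`exists_interleave`): `a, β, L, Z_m` read at `⌊k/2⌋`,
`m_crit'(k) = m_crit(⌊k/2⌋) + (k mod 2)·a M/Z_m`, so even steps of `reg'.scheme m` are steps of `reg.scheme m` and odd
steps those of `reg.scheme (m + M·1)`.
* §2 `interleave_hasMassScaling / _hasAsymptoticScaling / _lowerLaw / _upperLaw`: `reg'` satisfies ALL FOUR
  hypotheses again, window `(m₁ − M, c, C)` — the lower law because `reg`'s covers `m` and `m + M·1` (rate monotone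
  in the masses), the upper law because `¬ HasLatticeMassGap E` is a FREQUENTLY-in-`k` statement witnessed along the
  even steps.  The hypotheses are blind to a period-two oscillation of all renormalised quark masses by `M`.
* §3 `massiveBody_massBlind`: so `MassiveBody` yields, for every such `reg`, `0 ≤ M < m₁`, `m > 0`, ONE `T`
  (non-trivial non-Gaussian glue, non-decoupled flavoured pseudoscalars, gap) that is `IsQCDAlong` BOTH
  `reg.scheme m z₁ s₁` AND `reg.scheme (m + M·1) z₂ s₂`, with one common uniform lattice gap;
  `chiralWindow_massiveBody_massBlind`: with the route's target `ChiralWindow` this holds along ONE honest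
  regularisation — QCD at quark masses `m` and at `m + M·1` with the SAME continuum Schwinger functions of glue and
  of every `Re ψ̄_f iγ₅ ψ_g` up to per-step field renormalisations, against `m_π² ∝ m_q` (GMOR), the route's own
  dictionary.  Physically `ChiralWindow ∧ MassiveBody` is inconsistent (the item set can only hold vacuously);
  formally neither is refutable here.
Repairs this witness MISSES (planner's call): (a) the ∃-form `(∃ reg, scaling ∧ window) → ∃ reg, scaling ∧ window ∧
body` (`closes` adapts line by line); (b) keep `∀ reg` but make the UPPER window law an EVENTUAL correlator lower
bound (as `SpinWaveLaws` delivers), which pins `m_crit(k)` along the full sequence.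
No `def`; sorry-free; axioms `propext`, `Classical.choice`, `Quot.sound`.  Refs: birth.md §Caveat; Montvay–Münster
§5.1 (additive mass renormalisation known to `O(aΛ)` only); Gell-Mann–Oakes–Renner 1968.
-/

noncomputable section

open Literature.MathematicalPhysics.QuantumFieldTheory Literature.Probability.LatticeModels
  Literature.MathematicalPhysics.QuantumLattice
open MeasureTheory Filter Topology
open scoped SchwartzMap

namespace Summit.QuantumFields.QCD.Theorems.MassiveBody.Negative

open Summit.QuantumFields.QCD.Theses.ChiralSpinWaves (MassiveBody ChiralWindow)

variable {Nf : ℕ}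

/-! ## §0 Index bookkeeping -/

/-- An eventual property along a sequence holds eventually along any `φ` with `j ≤ φ j`. [folklore] -/
theorem eventually_along {P : ℕ → Prop} (φ : ℕ → ℕ) (hφ : ∀ j, j ≤ φ j) (h : ∀ᶠ k in atTop, P k) :
    ∀ᶠ j in atTop, P (φ j) := by
  obtain ⟨N, hN⟩ := eventually_atTop.1 h
  exact eventually_atTop.2 ⟨N, fun j hj => hN _ (hj.trans (hφ j))⟩

/-- Interleaving two eventual properties (even and odd steps). [folklore] -/
theorem eventually_interleave {R : ℕ → Prop} (h0 : ∀ᶠ j in atTop, R (2 * j))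
    (h1 : ∀ᶠ j in atTop, R (2 * j + 1)) : ∀ᶠ k in atTop, R k := by
  obtain ⟨N₀, hN₀⟩ := eventually_atTop.1 h0
  obtain ⟨N₁, hN₁⟩ := eventually_atTop.1 h1
  refine eventually_atTop.2 ⟨2 * (N₀ + N₁), fun k hk => ?_⟩
  obtain ⟨j, rfl | rfl⟩ := Nat.even_or_odd' k
  · exact hN₀ j (by omega)
  · exact hN₁ j (by omega)

/-! ## §1 The lattice `n`-point functions depend on the scheme only through the data at the step -/

/-- **Congruence of the lattice Schwinger functions**: two schemes with the same `L, β, a, m_f, z, shift` at steps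
`k₁`, `k₂` have the same lattice `n`-point functions there. [folklore] -/
theorem qcdLatticeSchwinger_congr {sch₁ sch₂ : QCDScheme Nf} {k₁ k₂ : ℕ}
    (hL : sch₁.L k₁ = sch₂.L k₂) (hβ : sch₁.β k₁ = sch₂.β k₂) (ha : sch₁.a k₁ = sch₂.a k₂)
    (hmq : (fun fl => sch₁.mq fl k₁) = fun fl => sch₂.mq fl k₂)
    (hz : (fun s => sch₁.z s k₁) = fun s => sch₂.z s k₂)
    (hs : (fun s => sch₁.shift s k₁) = fun s => sch₂.shift s k₂)
    (n : ℕ) (σ : Fin n → QCDField Nf) (f : Fin n → 𝓢(EuclideanSpace ℝ (Fin 4), ℝ)) :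
    qcdLatticeSchwinger sch₁ k₁ n σ f = qcdLatticeSchwinger sch₂ k₂ n σ f := by
  let R : ℕ → ℝ → ℝ → (Fin Nf → ℝ) → (QCDField Nf → ℝ) → (QCDField Nf → ℝ) → ℂ :=
    fun L β a mq z shift =>
      (∫ U, fermiIntegral ((List.ofFn fun i =>
          ∑ x ∈ box 4 L, ((z (σ i) * a ^ 4 * f i (a • siteToE x) : ℝ) : ℂ) •
            (insertion U (σ i) x - algebraMap ℂ _ ((shift (σ i) : ℝ) : ℂ))).prod *
          fermiBoltzmann U mq)
          ∂(wilsonMeasure (d := 4) (L := 2 * L + 1) (fundamentalRep (Fin 3)) β)) /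
        ∫ U, fermiIntegral (fermiBoltzmann U mq)
          ∂(wilsonMeasure (d := 4) (L := 2 * L + 1) (fundamentalRep (Fin 3)) β)
  have h₁ : qcdLatticeSchwinger sch₁ k₁ n σ f = R (sch₁.L k₁) (sch₁.β k₁) (sch₁.a k₁)
      (fun fl => sch₁.mq fl k₁) (fun s => sch₁.z s k₁) (fun s => sch₁.shift s k₁) := rfl
  have h₂ : qcdLatticeSchwinger sch₂ k₂ n σ f = R (sch₂.L k₂) (sch₂.β k₂) (sch₂.a k₂)
      (fun fl => sch₂.mq fl k₂) (fun s => sch₂.z s k₂) (fun s => sch₂.shift s k₂) := rfl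
  rw [h₁, h₂, hL, hβ, ha, hmq, hz, hs]

/-- **Uniform lattice gap along a dilated subsequence.** If the steps `φ j ≥ j` of `sch` carry the data of the
steps `j` of `sch₀`, a uniform lattice gap of `sch` is one of `sch₀`. [folklore] -/
theorem latticeGap_along {sch sch₀ : QCDScheme Nf} {Δ : ℝ} (φ : ℕ → ℕ) (hφ : ∀ j, j ≤ φ j)
    (h : sch.HasLatticeMassGap Δ)
    (hL : ∀ j, sch.L (φ j) = sch₀.L j) (hβ : ∀ j, sch.β (φ j) = sch₀.β j)
    (ha : ∀ j, sch.a (φ j) = sch₀.a j)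
    (hmq : ∀ j, (fun fl => sch.mq fl (φ j)) = fun fl => sch₀.mq fl j) :
    sch₀.HasLatticeMassGap Δ := by
  intro R R' A B
  obtain ⟨C₀, hC₀⟩ := h R R' A B
  obtain ⟨N, hN⟩ := eventually_atTop.1 hC₀
  refine ⟨C₀, eventually_atTop.2 ⟨N, fun j hj S hS n hn => ?_⟩⟩
  have := hN (φ j) (hj.trans (hφ j)) S (by rw [hL]; exact hS) n hn
  rwa [hβ, hmq, ha] at this

/-- **Interleaving two uniform lattice gaps.** If the even steps of `sch` carry the data of `sch₀` and the odd
steps those of `sch₁`, uniform lattice gaps `Δ` of `sch₀` and `sch₁` give one of `sch`. [folklore] -/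
theorem latticeGap_interleave {sch sch₀ sch₁ : QCDScheme Nf} {Δ : ℝ}
    (h₀ : sch₀.HasLatticeMassGap Δ) (h₁ : sch₁.HasLatticeMassGap Δ)
    (hL₀ : ∀ j, sch.L (2 * j) = sch₀.L j) (hβ₀ : ∀ j, sch.β (2 * j) = sch₀.β j)
    (ha₀ : ∀ j, sch.a (2 * j) = sch₀.a j)
    (hmq₀ : ∀ j, (fun fl => sch.mq fl (2 * j)) = fun fl => sch₀.mq fl j)
    (hL₁ : ∀ j, sch.L (2 * j + 1) = sch₁.L j) (hβ₁ : ∀ j, sch.β (2 * j + 1) = sch₁.β j)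
    (ha₁ : ∀ j, sch.a (2 * j + 1) = sch₁.a j)
    (hmq₁ : ∀ j, (fun fl => sch.mq fl (2 * j + 1)) = fun fl => sch₁.mq fl j) :
    sch.HasLatticeMassGap Δ := by
  intro R R' A B
  obtain ⟨C₀, hC₀⟩ := h₀ R R' A B
  obtain ⟨C₁, hC₁⟩ := h₁ R R' A B
  obtain ⟨N₀, hN₀⟩ := eventually_atTop.1 hC₀
  obtain ⟨N₁, hN₁⟩ := eventually_atTop.1 hC₁
  refine ⟨|C₀| + |C₁|, eventually_atTop.2 ⟨2 * (N₀ + N₁), fun k hk => ?_⟩⟩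
  obtain ⟨j, rfl | rfl⟩ := Nat.even_or_odd' k
  · intro S hS n hn
    rw [hL₀] at hS
    rw [hβ₀, hmq₀, ha₀]
    refine (hN₀ j (by omega) S hS n hn).trans (mul_le_mul_of_nonneg_right ?_ (Real.exp_pos _).le)
    linarith [le_abs_self C₀, abs_nonneg C₁]
  · intro S hS n hn
    rw [hL₁] at hS
    rw [hβ₁, hmq₁, ha₁]
    refine (hN₁ j (by omega) S hS n hn).trans (mul_le_mul_of_nonneg_right ?_ (Real.exp_pos _).le)
    linarith [le_abs_self C₁, abs_nonneg C₀]

/-- **Monotonicity of the uniform lattice gap in the rate.** [folklore] -/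
theorem latticeGap_mono {sch : QCDScheme Nf} {Δ Δ' : ℝ} (h : sch.HasLatticeMassGap Δ') (hle : Δ ≤ Δ') :
    sch.HasLatticeMassGap Δ := by
  intro R R' A B
  obtain ⟨C₀, h₀⟩ := h R R' A B
  refine ⟨|C₀|, h₀.mono fun k hk S hS n hn => (hk S hS n hn).trans ?_⟩
  have hx : 0 ≤ sch.a k * n := mul_nonneg (sch.a_pos k).le (Nat.cast_nonneg n)
  calc C₀ * Real.exp (-(Δ' * (sch.a k * n)))
      ≤ |C₀| * Real.exp (-(Δ' * (sch.a k * n))) :=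
        mul_le_mul_of_nonneg_right (le_abs_self _) (Real.exp_pos _).le
    _ ≤ |C₀| * Real.exp (-(Δ * (sch.a k * n))) :=
        mul_le_mul_of_nonneg_left (Real.exp_le_exp.2 (by nlinarith [mul_le_mul_of_nonneg_right hle hx]))
          (abs_nonneg _)

/-- **`IsQCDAlong` along a dilated subsequence.** If the steps `φ j ≥ j` of `sch` carry the data of the steps `j`
of `sch₀` (volumes, couplings, spacings, bare masses AND species renormalisations), OS data that are QCD along
`sch` are QCD along `sch₀`: the lattice `n`-point functions of `sch₀` are a subsequence of those of `sch`. [folklore] -/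
theorem isQCDAlong_along {sch sch₀ : QCDScheme Nf} {T : OSData (QCDField Nf) 4} (φ : ℕ → ℕ)
    (hφ : ∀ j, j ≤ φ j) (h : IsQCDAlong sch T) (h₀ : sch₀.HasAsymptoticScaling)
    (hL : ∀ j, sch.L (φ j) = sch₀.L j) (hβ : ∀ j, sch.β (φ j) = sch₀.β j)
    (ha : ∀ j, sch.a (φ j) = sch₀.a j)
    (hmq : ∀ j, (fun fl => sch.mq fl (φ j)) = fun fl => sch₀.mq fl j)
    (hz : ∀ j, (fun s => sch.z s (φ j)) = fun s => sch₀.z s j)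
    (hs : ∀ j, (fun s => sch.shift s (φ j)) = fun s => sch₀.shift s j) :
    IsQCDAlong sch₀ T := by
  have hφt : Tendsto φ atTop atTop := tendsto_atTop_mono hφ tendsto_id
  refine ⟨h₀, fun fl => ?_, fun n hn σ f F hF hoff => ?_⟩
  · refine (eventually_along φ hφ (h.2.1 fl)).mono fun j hj => ?_
    have e : sch.mq fl (φ j) = sch₀.mq fl j := congrFun (hmq j) fl
    rw [← e]; exact hj
  · refine Tendsto.congr (fun j => ?_) ((h.2.2 n hn σ f F hF hoff).comp hφt)
    exact qcdLatticeSchwinger_congr (hL j) (hβ j) (ha j) (hmq j) (hz j) (hs j) n σ f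

/-! ## §2 The interleaved regularisation and the invariance of the four hypotheses -/

/-- **The period-two interleaving of `reg` with its RGI up-shift by `M`** exists as a `QCDRegularisation`:
`a, β, L, Z_m` at step `⌊k/2⌋`, `m_crit'(k) = m_crit(⌊k/2⌋) + (k mod 2) · a M / Z_m`. [folklore] -/
theorem exists_interleave (reg : QCDRegularisation Nf) (M : ℝ) :
    ∃ reg' : QCDRegularisation Nf,
      (∀ k, reg'.a k = reg.a (k / 2)) ∧ (∀ k, reg'.β k = reg.β (k / 2)) ∧
      (∀ k, reg'.L k = reg.L (k / 2)) ∧ (∀ k, reg'.Zm k = reg.Zm (k / 2)) ∧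
      (∀ k, reg'.mcrit k =
        reg.mcrit (k / 2) + reg.a (k / 2) * (((k % 2 : ℕ) : ℝ) * M) / reg.Zm (k / 2)) :=
  ⟨{ a := fun k => reg.a (k / 2)
     a_pos := fun _ => reg.a_pos _
     tendsto_a := reg.tendsto_a.comp
       (tendsto_atTop_atTop.2 fun b => ⟨2 * b, fun k hk => by omega⟩ : Tendsto (fun k : ℕ => k / 2) atTop atTop)
     β := fun k => reg.β (k / 2)
     L := fun k => reg.L (k / 2)
     tendsto_L := reg.tendsto_L.comp
       (tendsto_atTop_atTop.2 fun b => ⟨2 * b, fun k hk => by omega⟩ : Tendsto (fun k : ℕ => k / 2) atTop atTop)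
     mcrit := fun k => reg.mcrit (k / 2) + reg.a (k / 2) * (((k % 2 : ℕ) : ℝ) * M) / reg.Zm (k / 2)
     Zm := fun k => reg.Zm (k / 2)
     Zm_pos := fun _ => reg.Zm_pos _ },
    fun _ => rfl, fun _ => rfl, fun _ => rfl, fun _ => rfl, fun _ => rfl⟩

section Interleave

variable (reg reg' : QCDRegularisation Nf) (M : ℝ)
  (ha' : ∀ k, reg'.a k = reg.a (k / 2)) (hβ' : ∀ k, reg'.β k = reg.β (k / 2))
  (hL' : ∀ k, reg'.L k = reg.L (k / 2)) (hZ' : ∀ k, reg'.Zm k = reg.Zm (k / 2))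
  (hmc' : ∀ k, reg'.mcrit k =
    reg.mcrit (k / 2) + reg.a (k / 2) * (((k % 2 : ℕ) : ℝ) * M) / reg.Zm (k / 2))

include ha' in
/-- Even and odd spacings. [folklore] -/
theorem interleave_a_eq : (∀ j, reg'.a (2 * j) = reg.a j) ∧ ∀ j, reg'.a (2 * j + 1) = reg.a j := by
  constructor <;> (intro j; rw [ha']; congr 1; omega)

include hβ' in
/-- Even and odd couplings. [folklore] -/
theorem interleave_β_eq : (∀ j, reg'.β (2 * j) = reg.β j) ∧ ∀ j, reg'.β (2 * j + 1) = reg.β j := by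
  constructor <;> (intro j; rw [hβ']; congr 1; omega)

include hL' in
/-- Even and odd volumes. [folklore] -/
theorem interleave_L_eq : (∀ j, reg'.L (2 * j) = reg.L j) ∧ ∀ j, reg'.L (2 * j + 1) = reg.L j := by
  constructor <;> (intro j; rw [hL']; congr 1; omega)

include ha' hZ' hmc' in
/-- **Even bare trajectories are those of `reg` at `m`.** [folklore] -/
theorem interleave_mq_even (m : Fin Nf → ℝ) (z s z₀ s₀ : QCDField Nf → ℕ → ℝ) (j : ℕ) :
    (fun fl => (reg'.scheme m z s).mq fl (2 * j)) = fun fl => (reg.scheme m z₀ s₀).mq fl j := by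
  funext fl
  have h1 : 2 * j / 2 = j := by omega
  have h2 : 2 * j % 2 = 0 := by omega
  simp only [QCDRegularisation.scheme_mq, hmc', ha', hZ', h1, h2]
  push_cast
  ring

include ha' hZ' hmc' in
/-- **Odd bare trajectories are those of `reg` at `m + M·1`.** [folklore] -/
theorem interleave_mq_odd (m : Fin Nf → ℝ) (z s z₁ s₁ : QCDField Nf → ℕ → ℝ) (j : ℕ) :
    (fun fl => (reg'.scheme m z s).mq fl (2 * j + 1)) =
      fun fl => (reg.scheme (fun f => m f + M) z₁ s₁).mq fl j := by
  funext fl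
  have h1 : (2 * j + 1) / 2 = j := by omega
  have h2 : (2 * j + 1) % 2 = 1 := by omega
  simp only [QCDRegularisation.scheme_mq, hmc', ha', hZ', h1, h2]
  push_cast
  ring

include ha' hZ' in
/-- **Mass scaling passes to the interleaving** (`Z_m`, `a` are read at `⌊k/2⌋`). [folklore] -/
theorem interleave_hasMassScaling (hms : reg.HasMassScaling) : reg'.HasMassScaling := by
  obtain ⟨c₀, hc₀, hZ⟩ := hms
  refine ⟨c₀, hc₀, ?_⟩
  have : (fun k => reg'.Zm k / Real.log (1 / reg'.a k ^ 2) ^ massExponent Nf) =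
      (fun j => reg.Zm j / Real.log (1 / reg.a j ^ 2) ^ massExponent Nf) ∘ fun k => k / 2 := by
    funext k; simp only [Function.comp, hZ', ha']
  rw [this]
  exact hZ.comp (tendsto_atTop_atTop.2 fun b => ⟨2 * b, fun k hk => by omega⟩ : Tendsto (fun k : ℕ => k / 2) atTop atTop)

include ha' hβ' in
/-- **Asymptotic scaling passes to the interleaving** (`β`, `a` are read at `⌊k/2⌋`). [folklore] -/
theorem interleave_hasAsymptoticScaling (haf : (reg.scheme 0 0 0).HasAsymptoticScaling) :
    (reg'.scheme 0 0 0).HasAsymptoticScaling := by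
  obtain ⟨Λ, hΛ, hβ⟩ := haf
  refine ⟨Λ, hΛ, ?_⟩
  have : (fun k => (reg'.scheme 0 0 0).β k - afBeta Nf Λ ((reg'.scheme 0 0 0).a k)) =
      (fun j => (reg.scheme 0 0 0).β j - afBeta Nf Λ ((reg.scheme 0 0 0).a j)) ∘ fun k => k / 2 := by
    funext k
    show reg'.β k - afBeta Nf Λ (reg'.a k) = reg.β (k / 2) - afBeta Nf Λ (reg.a (k / 2))
    rw [hβ', ha']
  rw [this]
  exact hβ.comp (tendsto_atTop_atTop.2 fun b => ⟨2 * b, fun k hk => by omega⟩ : Tendsto (fun k : ℕ => k / 2) atTop atTop)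

include ha' hβ' hL' hZ' hmc' in
/-- **The LOWER window law passes to the interleaving, with window `m₁ − M` and the same rate constant `c`**
(`0 ≤ M`): at even steps it is `reg`'s lower law at `m`, at odd steps `reg`'s lower law at `m + M·1 ≤ m₁`, whose
rate `c √(inf (m_f + m_g + 2M))` dominates `c √(inf (m_f + m_g))`. [folklore] -/
theorem interleave_lowerLaw {m₁ c : ℝ} (hc : 0 < c) (hM : 0 ≤ M)
    (hlow : ∀ m : Fin Nf → ℝ, (∀ f, 0 < m f) → (∀ f, m f ≤ m₁) →
      (∀ f, ∀ᶠ k in atTop, (-1 : ℝ) < (reg.scheme m 0 0).mq f k) ∧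
        (reg.scheme m 0 0).HasLatticeMassGap
          (c * Real.sqrt (⨅ p : {p : Fin Nf × Fin Nf // p.1 ≠ p.2}, (m p.1.1 + m p.1.2)))) :
    ∀ m : Fin Nf → ℝ, (∀ f, 0 < m f) → (∀ f, m f ≤ m₁ - M) →
      (∀ f, ∀ᶠ k in atTop, (-1 : ℝ) < (reg'.scheme m 0 0).mq f k) ∧
        (reg'.scheme m 0 0).HasLatticeMassGap
          (c * Real.sqrt (⨅ p : {p : Fin Nf × Fin Nf // p.1 ≠ p.2}, (m p.1.1 + m p.1.2))) := by
  intro m hm hle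
  obtain ⟨hpb₀, hgap₀⟩ := hlow m hm (fun f => by linarith [hle f])
  obtain ⟨hpb₁, hgap₁⟩ :=
    hlow (fun f => m f + M) (fun f => by linarith [hm f]) (fun f => by linarith [hle f])
  have hmq₀ := interleave_mq_even reg reg' M ha' hZ' hmc' m 0 0 0 0
  have hmq₁ := interleave_mq_odd reg reg' M ha' hZ' hmc' m 0 0 0 0
  refine ⟨fun fl => eventually_interleave ?_ ?_, ?_⟩
  · refine (hpb₀ fl).mono fun j hj => ?_
    have e : (reg'.scheme m 0 0).mq fl (2 * j) = (reg.scheme m 0 0).mq fl j := congrFun (hmq₀ j) fl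
    rw [e]; exact hj
  · refine (hpb₁ fl).mono fun j hj => ?_
    have e : (reg'.scheme m 0 0).mq fl (2 * j + 1) = (reg.scheme (fun f => m f + M) 0 0).mq fl j :=
      congrFun (hmq₁ j) fl
    rw [e]; exact hj
  · have hΔ : c * Real.sqrt (⨅ p : {p : Fin Nf × Fin Nf // p.1 ≠ p.2}, (m p.1.1 + m p.1.2)) ≤
        c * Real.sqrt (⨅ p : {p : Fin Nf × Fin Nf // p.1 ≠ p.2}, ((m p.1.1 + M) + (m p.1.2 + M))) := by
      refine mul_le_mul_of_nonneg_left (Real.sqrt_le_sqrt ?_) hc.le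
      exact ciInf_mono (Set.finite_range _).bddBelow fun p => by linarith
    exact latticeGap_interleave hgap₀ (latticeGap_mono hgap₁ hΔ)
      (interleave_L_eq reg reg' hL').1 (interleave_β_eq reg reg' hβ').1 (interleave_a_eq reg reg' ha').1
      hmq₀ (interleave_L_eq reg reg' hL').2 (interleave_β_eq reg reg' hβ').2 (interleave_a_eq reg reg' ha').2
      hmq₁

include ha' hβ' hL' hZ' hmc' in
/-- **The UPPER window law passes to the interleaving, with the same constant `C`** (window `m₁ − M`,
`0 ≤ M`): `¬ HasLatticeMassGap E` is a frequently-in-`k` statement, and a uniform gap of the interleaved scheme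
at the degenerate tuple `t·1` would restrict to one of `reg` along the even steps. [folklore] -/
theorem interleave_upperLaw {m₁ C : ℝ} (hM : 0 ≤ M)
    (hup : ∀ t : ℝ, 0 < t → t ≤ m₁ → ∀ E : ℝ, C * Real.sqrt t < E →
      ¬ (reg.scheme (fun _ => t) 0 0).HasLatticeMassGap E) :
    ∀ t : ℝ, 0 < t → t ≤ m₁ - M → ∀ E : ℝ, C * Real.sqrt t < E →
      ¬ (reg'.scheme (fun _ => t) 0 0).HasLatticeMassGap E := by
  intro t ht htle E hE hgap
  refine hup t ht (by linarith) E hE ?_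
  exact latticeGap_along (fun j => 2 * j) (fun j => by omega) hgap
    (interleave_L_eq reg reg' hL').1 (interleave_β_eq reg reg' hβ').1 (interleave_a_eq reg reg' ha').1
    (interleave_mq_even reg reg' M ha' hZ' hmc' (fun _ => t) 0 0 0 0)

end Interleave

/-! ## §3 `MassiveBody` forces mass-blind continuum limits -/

/-- **`MassiveBody` forces mass-blind continuum limits along every window regularisation.**  For every
`N_f ∈ {2,3}`, every regularisation `reg` satisfying the four hypotheses of `MassiveBody` (mass scaling, asymptotic
scaling, lower and upper window law with constants `m₁, c, C`), every shift `0 ≤ M < m₁` and every positive mass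
tuple `m`, there are OS data `T` with non-trivial non-Gaussian glue, non-decoupled flavoured pseudoscalars and a
mass gap that are SIMULTANEOUSLY QCD along `reg` at renormalised masses `m` and at `m + M·1` (with species
renormalisations `z₁, s₁` resp. `z₂, s₂`), both lattice theories carrying one common uniform lattice gap.
Proof: apply `MassiveBody` to the interleaving of `reg` with its up-shift by `M` (§2) and split the conclusion
along even and odd steps (§1). [folklore] -/
theorem massiveBody_massBlind (h : MassiveBody) (hNf : Nf = 2 ∨ Nf = 3)
    (reg : QCDRegularisation Nf) (hms : reg.HasMassScaling)
    (haf : (reg.scheme 0 0 0).HasAsymptoticScaling) {m₁ c C : ℝ} (hc : 0 < c) (hC : 0 < C)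
    (hlow : ∀ m : Fin Nf → ℝ, (∀ f, 0 < m f) → (∀ f, m f ≤ m₁) →
      (∀ f, ∀ᶠ k in atTop, (-1 : ℝ) < (reg.scheme m 0 0).mq f k) ∧
        (reg.scheme m 0 0).HasLatticeMassGap
          (c * Real.sqrt (⨅ p : {p : Fin Nf × Fin Nf // p.1 ≠ p.2}, (m p.1.1 + m p.1.2))))
    (hup : ∀ t : ℝ, 0 < t → t ≤ m₁ → ∀ E : ℝ, C * Real.sqrt t < E →
      ¬ (reg.scheme (fun _ => t) 0 0).HasLatticeMassGap E)
    {M : ℝ} (hM : 0 ≤ M) (hMlt : M < m₁) (m : Fin Nf → ℝ) (hm : ∀ f, 0 < m f) :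
    ∃ (T : OSData (QCDField Nf) 4) (z₁ s₁ z₂ s₂ : QCDField Nf → ℕ → ℝ),
      IsQCDAlong (reg.scheme m z₁ s₁) T ∧ IsQCDAlong (reg.scheme (fun f => m f + M) z₂ s₂) T ∧
      T.IsNontrivial QCDField.glue ∧ T.IsNonGaussian QCDField.glue ∧
      (∀ f g : Fin Nf, f ≠ g → T.IsNontrivial (QCDField.pseudoRe f g)) ∧
      ∃ Δ > 0, T.HasMassGap Δ ∧ (reg.scheme m 0 0).HasLatticeMassGap Δ ∧
        (reg.scheme (fun f => m f + M) 0 0).HasLatticeMassGap Δ := by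
  obtain ⟨reg', ha', hβ', hL', hZ', hmc'⟩ := exists_interleave reg M
  -- the interleaving satisfies all four hypotheses of `MassiveBody`, window `(m₁ - M, c, C)`
  have hms' := interleave_hasMassScaling reg reg' ha' hZ' hms
  have haf' := interleave_hasAsymptoticScaling reg reg' ha' hβ' haf
  have hlow' := interleave_lowerLaw reg reg' M ha' hβ' hL' hZ' hmc' hc hM hlow
  have hup' := interleave_upperLaw reg reg' M ha' hβ' hL' hZ' hmc' hM hup
  obtain ⟨z, s, T, hQ, hnt, hng, hps, Δ, hΔ, hT, hlat⟩ :=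
    h Nf hNf reg' hms' haf' ⟨m₁ - M, by linarith, c, hc, C, hC, hlow', hup'⟩ m hm
  -- split the conclusion along even / odd steps
  refine ⟨T, fun s' j => z s' (2 * j), fun s' j => s s' (2 * j), fun s' j => z s' (2 * j + 1),
    fun s' j => s s' (2 * j + 1), ?_, ?_, hnt, hng, hps, Δ, hΔ, hT, ?_, ?_⟩
  · exact isQCDAlong_along (fun j => 2 * j) (fun j => by omega) hQ haf
      (interleave_L_eq reg reg' hL').1 (interleave_β_eq reg reg' hβ').1 (interleave_a_eq reg reg' ha').1
      (interleave_mq_even reg reg' M ha' hZ' hmc' m z s _ _) (fun _ => rfl) (fun _ => rfl)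
  · exact isQCDAlong_along (fun j => 2 * j + 1) (fun j => by omega) hQ haf
      (interleave_L_eq reg reg' hL').2 (interleave_β_eq reg reg' hβ').2 (interleave_a_eq reg reg' ha').2
      (interleave_mq_odd reg reg' M ha' hZ' hmc' m z s _ _) (fun _ => rfl) (fun _ => rfl)
  · exact latticeGap_along (fun j => 2 * j) (fun j => by omega) hlat
      (interleave_L_eq reg reg' hL').1 (interleave_β_eq reg reg' hβ').1 (interleave_a_eq reg reg' ha').1
      (interleave_mq_even reg reg' M ha' hZ' hmc' m z s 0 0)
  · exact latticeGap_along (fun j => 2 * j + 1) (fun j => by omega) hlat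
      (interleave_L_eq reg reg' hL').2 (interleave_β_eq reg reg' hβ').2 (interleave_a_eq reg reg' ha').2
      (interleave_mq_odd reg reg' M ha' hZ' hmc' m z s 0 0)

/-- **Under the route's target `ChiralWindow`, `MassiveBody` makes QCD mass-blind along one honest
regularisation**: for `N_f ∈ {2,3}` there are a regularisation `reg` with mass scaling and a window constant
`m₁ > 0` such that for EVERY shift `0 ≤ M < m₁` and EVERY positive mass tuple `m`, lattice QCD along `reg` at
masses `m` and at masses `m + M·1` has COMMON continuum OS data (non-trivial non-Gaussian glue, every flavoured
pseudoscalar non-decoupled, a mass gap) and a common uniform lattice gap — hadron physics independent of a quark-mass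
shift by `M`, against `m_π² ∝ m_q`.  The kernel-checked form of birth.md's caveat: `ChiralWindow ∧ MassiveBody`
is physically inconsistent, so the route's item set can only hold vacuously. [folklore] -/
theorem chiralWindow_massiveBody_massBlind (hW : ChiralWindow) (h : MassiveBody) (hNf : Nf = 2 ∨ Nf = 3) :
    ∃ (reg : QCDRegularisation Nf) (m₁ : ℝ), 0 < m₁ ∧ reg.HasMassScaling ∧
      (reg.scheme 0 0 0).HasAsymptoticScaling ∧
      ∀ M : ℝ, 0 ≤ M → M < m₁ → ∀ m : Fin Nf → ℝ, (∀ f, 0 < m f) →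
        ∃ (T : OSData (QCDField Nf) 4) (z₁ s₁ z₂ s₂ : QCDField Nf → ℕ → ℝ),
          IsQCDAlong (reg.scheme m z₁ s₁) T ∧ IsQCDAlong (reg.scheme (fun f => m f + M) z₂ s₂) T ∧
          T.IsNontrivial QCDField.glue ∧ T.IsNonGaussian QCDField.glue ∧
          (∀ f g : Fin Nf, f ≠ g → T.IsNontrivial (QCDField.pseudoRe f g)) ∧
          ∃ Δ > 0, T.HasMassGap Δ ∧ (reg.scheme m 0 0).HasLatticeMassGap Δ ∧
            (reg.scheme (fun f => m f + M) 0 0).HasLatticeMassGap Δ := by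
  obtain ⟨reg, hms, haf, m₁, hm₁, c, hc, C, hC, hlow, hup⟩ := hW Nf hNf
  exact ⟨reg, m₁, hm₁, hms, haf, fun M hM hMlt m hm =>
    massiveBody_massBlind h hNf reg hms haf hc hC hlow hup hM hMlt m hm⟩

end Summit.QuantumFields.QCD.Theorems.MassiveBody.Negative

end
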